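import Summits.QuantumFields.YangMills.Theorems.BalabanUVNodesN15KingModelAnalyticDeterminantSecondOrderTaylor
import HarnessLib

/-!
# BalabanUVNodes ∕ N15 — THE KING-MODEL RUNG (PART Ϯ-i): THE EXACT SECOND-ORDER FORMULA — `ln det Δ_eff(U) − ln det Δ_eff(V) = tr(C(V)E) − ∫₀¹(1−t)·tr(Δ_t⁻¹EΔ_t⁻¹E) dt`
# (Taylor with INTEGRAL remainder for King's block-field normalisation between two real-orthogonal backgrounds: the fundamental theorem of calculus applied to `t ↦ ln det Δ_t + (1−t)·tr(Δ_t⁻¹E)`,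
# whose derivative is `−(1−t)·tr(Δ_t⁻¹EΔ_t⁻¹E)` by PART Ϭ-l and PART Ϯ-g), and the remainder's two-sided size `∫₀¹(1−t)(…) ∈ [½a⁻²tr(E²), ½β♯⁻²tr(E²)]` recovered from the exact formula
# (Track A, DAG node N15 = NE2; FAN-OUT v1.1 §N15 s3 «KING-MODEL RUNG … + what the curved case adds»; count-neutral)

HONEST FRAMING.  Count-neutral (cell `pub-ymgap`, seat `pub-ymgap-dag-n15-e` g54; `--supports stmt-QuantumFields-27247 --as helper` = K3ᴬ, KEY MAP v3).  King's one-level comparison model, `𝕜 = ℝ`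
(real-orthogonal backgrounds), `a, m² > 0`, `c ≥ 0`, nonempty fibre; interpolation linear in the operator.  King's (3.94)–(3.96) (p.669) telescopes `ln[Z(A)Z(0)⁻¹]` and expands each increment to
second order; PART Ϭ-m gave the exact FIRST-order integral, THIS FILE the exact SECOND-order one.  NOT (3.97)–(3.98); NOT a node discharge (N15 of record untouched); nothing continuum ∕ ℝ⁴ ∕ OS ∕ Clay.

CONTENT.  §1 (generic real matrices, `det(W+sE) ≠ 0` on `[0,1]`): `hasDerivAt_log_det_add_taylor_affine` (`∂_s[ln det(W+sE) + (1−s)tr((W+sE)⁻¹E)] = −(1−s)tr((W+sE)⁻¹E(W+sE)⁻¹E)`),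
`continuousOn_second_variation_affine`, ★★★ **`log_det_sub_eq_trace_sub_integral`** (`ln det(W+E) − ln det W = tr(W⁻¹E) − ∫₀¹(1−s)tr((W+sE)⁻¹E(W+sE)⁻¹E)ds`); §2 (model) ★★★★
**`log_det_effLapU_sub_eq_trace_sub_integral`** (the exact second-order formula for `Δ_eff`), ★★★ `integral_second_variation_mem_Icc` (the remainder `∫₀¹(1−t)tr(Δ_t⁻¹EΔ_t⁻¹E)dt` lies in
`[½a⁻²tr(E²), ½β♯⁻²tr(E²)]`, from Ϯ-h's two-sided Taylor bound and the exact formula).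

PRIOR TREE ART (by name, not restated): Ϭ-l `hasDerivAt_log_det_affine`, Ϭ-m `continuousAt_inv_affine`∕`continuousOn_trace_inv_affine_mul`, Ϯ-g `hasDerivAt_trace_inv_affine_mul_self`, Ϯ-h
`king396_two_sided_remainder`, Ϭ-l `posDef_effLapU_segment`, Mathlib `intervalIntegral.integral_eq_sub_of_hasDerivAt`.  Dedup (rg at filing): basename 0 files;
`hasDerivAt_log_det_add_taylor_affine|log_det_sub_eq_trace_sub_integral|log_det_effLapU_sub_eq_trace_sub_integral|integral_second_variation_mem_Icc` 0 tree files.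
Locators: [King1986] (3.94)–(3.96) p.669, (3.89)–(3.90) pp.668–669, (2.14) p.653; [Klingen1990] Ch. V §11 (15) p.141; [HornJohnson2013] 0.8.10 (0.8.10.1).  0 `sorry`, 0 `def`.
-/

noncomputable section

open scoped BigOperators ComplexConjugate ComplexOrder Matrix.Norms.L2Operator
open Finset Matrix MeasureTheory intervalIntegral

namespace Summit.QuantumFields.YangMills.BalabanUVNodes.N15KingModelRung.Analytic

open Literature.MathematicalPhysics.QuantumFieldTheory.Balaban1983to89.B5Prop11Plancherel (Tor fine)
open Summit.QuantumFields.YangMills.BalabanUVNodes.N15KingModelRung.CovariantBlock (BlockTree effLapU)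

/-! ## §1 Taylor with integral remainder along an affine path of real matrices -/

section Generic

variable {ι : Type*} [Fintype ι] [DecidableEq ι]

/-- `∂_s[ln|det(W+sE)| + (1−s)·tr((W+sE)⁻¹E)] = −(1−s)·tr((W+sE)⁻¹E(W+sE)⁻¹E)` wherever `det(W+sE) ≠ 0` (Ϭ-l Jacobi + Ϯ-g Klingen + product rule; the first-order terms cancel).
[cite: King1986, (3.94)–(3.96) p.669; Klingen1990, Ch. V §11 (15) p.141] -/
theorem hasDerivAt_log_det_add_taylor_affine (W E : Matrix ι ι ℝ) {t : ℝ} (hA : (W + t • E).det ≠ 0) :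
    HasDerivAt (fun s : ℝ => Real.log (W + s • E).det + (1 - s) * ((W + s • E)⁻¹ * E).trace)
      (-((1 - t) * ((W + t • E)⁻¹ * E * (W + t • E)⁻¹ * E).trace)) t := by
  have h1 := hasDerivAt_log_det_affine W E hA
  have h2 := hasDerivAt_trace_inv_affine_mul_self W E hA
  have h3 : HasDerivAt (fun s : ℝ => 1 - s) (-1) t := by simpa using (hasDerivAt_id t).const_sub 1
  have h := h1.add (h3.mul h2)
  exact h.congr_deriv (by ring)

/-- The second variation `s ↦ (1−s)·tr((W+sE)⁻¹E(W+sE)⁻¹E)` is continuous on any set where `det(W+sE) ≠ 0` (Ϭ-m `continuousAt_inv_affine`). [folklore] -/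
theorem continuousOn_second_variation_affine (W E : Matrix ι ι ℝ) {S : Set ℝ} (hS : ∀ s ∈ S, (W + s • E).det ≠ 0) :
    ContinuousOn (fun s : ℝ => (1 - s) * ((W + s • E)⁻¹ * E * (W + s • E)⁻¹ * E).trace) S := by
  refine fun t ht => ContinuousAt.continuousWithinAt ?_
  have hX := continuousAt_inv_affine W E (hS t ht)
  have h1 : ContinuousAt (fun s : ℝ => (W + s • E)⁻¹ * E * (W + s • E)⁻¹ * E) t := ((hX.mul continuousAt_const).mul hX).mul continuousAt_const
  have h2 : ContinuousAt (fun s : ℝ => ((W + s • E)⁻¹ * E * (W + s • E)⁻¹ * E).trace) t := (continuous_id.matrix_trace.continuousAt).comp h1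
  exact ((continuous_const.sub continuous_id).continuousAt).mul h2

/-- ★★★ **TAYLOR WITH INTEGRAL REMAINDER FOR `ln det` ALONG A LINE**: if `det(W+sE) ≠ 0` on `[0,1]` then
`ln|det(W+E)| − ln|det W| = tr(W⁻¹E) − ∫₀¹(1−s)·tr((W+sE)⁻¹E(W+sE)⁻¹E) ds`. [cite: King1986, (3.94)–(3.96) p.669; Klingen1990, Ch. V §11 (15) p.141; HornJohnson2013, 0.8.10 eq. (0.8.10.1)] -/
theorem log_det_sub_eq_trace_sub_integral (W E : Matrix ι ι ℝ) (hS : ∀ s ∈ Set.Icc (0 : ℝ) 1, (W + s • E).det ≠ 0) :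
    Real.log (W + E).det - Real.log W.det
      = (W⁻¹ * E).trace - ∫ s in (0 : ℝ)..1, (1 - s) * ((W + s • E)⁻¹ * E * (W + s • E)⁻¹ * E).trace := by
  have huIcc : Set.uIcc (0 : ℝ) 1 = Set.Icc 0 1 := Set.uIcc_of_le zero_le_one
  have hderiv : ∀ s ∈ Set.uIcc (0 : ℝ) 1, HasDerivAt (fun s : ℝ => Real.log (W + s • E).det + (1 - s) * ((W + s • E)⁻¹ * E).trace)
      (-((1 - s) * ((W + s • E)⁻¹ * E * (W + s • E)⁻¹ * E).trace)) s := by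
    intro s hs
    rw [huIcc] at hs
    exact hasDerivAt_log_det_add_taylor_affine W E (hS s hs)
  have hint : IntervalIntegrable (fun s : ℝ => -((1 - s) * ((W + s • E)⁻¹ * E * (W + s • E)⁻¹ * E).trace)) volume 0 1 := by
    refine ContinuousOn.intervalIntegrable ?_
    rw [huIcc]
    exact (continuousOn_second_variation_affine W E hS).neg
  have h := intervalIntegral.integral_eq_sub_of_hasDerivAt hderiv hint
  rw [intervalIntegral.integral_neg] at h
  simp only [one_smul, zero_smul, add_zero, sub_self, zero_mul, sub_zero, one_mul] at h
  linarith

end Generic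

/-! ## §2 The exact second-order formula for King's block-field normalisation -/

section Model

variable {d : ℕ} {L : ℕ} [NeZero L] (T : BlockTree d L) (M : Fin (d + 1) → ℕ) [hM : ∀ μ, NeZero (M μ)]
variable {n : Type*} [Fintype n] [DecidableEq n] [Nonempty n]
variable {a c m2 : ℝ} (ha : 0 < a) (hc : 0 ≤ c) (hm : 0 < m2)
variable {U V : Tor (fine L M) × Fin (d + 1) → Matrix n n ℝ} (hU : ∀ bd, U bd ∈ Matrix.unitaryGroup n ℝ) (hV : ∀ bd, V bd ∈ Matrix.unitaryGroup n ℝ)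
include ha hc hm hU hV

/-- ★★★★ **THE EXACT SECOND-ORDER FORMULA**: for any two real-orthogonal backgrounds, with `Δ_t = Δ_eff(V) + tE`, `E = Δ_eff(U) − Δ_eff(V)`,
`ln det Δ_eff(U) − ln det Δ_eff(V) = tr(Δ_eff(V)⁻¹E) − ∫₀¹(1−t)·tr(Δ_t⁻¹EΔ_t⁻¹E) dt` — King's (3.94)–(3.96) first two orders, EXACTLY, with the operator interpolated.
[cite: King1986, (3.94)–(3.96) p.669, (3.89)–(3.90) pp.668–669, (2.14) p.653; Klingen1990, Ch. V §11 (15) p.141] -/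
theorem log_det_effLapU_sub_eq_trace_sub_integral :
    Real.log (effLapU T M a c m2 U).det - Real.log (effLapU T M a c m2 V).det
      = ((effLapU T M a c m2 V)⁻¹ * (effLapU T M a c m2 U - effLapU T M a c m2 V)).trace
        - ∫ t in (0 : ℝ)..1, (1 - t) * ((effLapU T M a c m2 V + t • (effLapU T M a c m2 U - effLapU T M a c m2 V))⁻¹ * (effLapU T M a c m2 U - effLapU T M a c m2 V)
            * (effLapU T M a c m2 V + t • (effLapU T M a c m2 U - effLapU T M a c m2 V))⁻¹ * (effLapU T M a c m2 U - effLapU T M a c m2 V)).trace := by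
  have h := log_det_sub_eq_trace_sub_integral (effLapU T M a c m2 V) (effLapU T M a c m2 U - effLapU T M a c m2 V)
    (fun s hs => (posDef_effLapU_segment T M ha hc hm hU hV hs).det_pos.ne')
  rw [add_sub_cancel] at h
  exact h

/-- ★★★ **THE SIZE OF THE INTEGRAL REMAINDER**: `½a⁻²·tr(E²) ≤ ∫₀¹(1−t)·tr(Δ_t⁻¹EΔ_t⁻¹E) dt ≤ ½β♯⁻²·tr(E²)`, `β♯ = (a⁻¹+m⁻²)⁻¹` (the exact formula read against Ϯ-h's two-sided Taylor bound).
[cite: King1986, (3.96) p.669, (2.14) p.653, (4.33) p.674; Klingen1990, Ch. V §11 (15) p.141] -/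
theorem integral_second_variation_mem_Icc :
    (∫ t in (0 : ℝ)..1, (1 - t) * ((effLapU T M a c m2 V + t • (effLapU T M a c m2 U - effLapU T M a c m2 V))⁻¹ * (effLapU T M a c m2 U - effLapU T M a c m2 V)
          * (effLapU T M a c m2 V + t • (effLapU T M a c m2 U - effLapU T M a c m2 V))⁻¹ * (effLapU T M a c m2 U - effLapU T M a c m2 V)).trace)
      ∈ Set.Icc (1 / 2 * a⁻¹ ^ 2 * ((effLapU T M a c m2 U - effLapU T M a c m2 V) * (effLapU T M a c m2 U - effLapU T M a c m2 V)).trace)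
          (1 / 2 * (a⁻¹ + m2⁻¹) ^ 2 * ((effLapU T M a c m2 U - effLapU T M a c m2 V) * (effLapU T M a c m2 U - effLapU T M a c m2 V)).trace) := by
  have hexact := log_det_effLapU_sub_eq_trace_sub_integral T M ha hc hm hU hV
  have hb := king396_two_sided_remainder T M ha hc hm hU hV
  constructor <;> linarith [hb.1, hb.2]

end Model

end Summit.QuantumFields.YangMills.BalabanUVNodes.N15KingModelRung.Analytic

end
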